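import Literature.AlgebraicGeometry.ShimuraVarieties.UnitaryShimuraCanonicalModel     -- ★ `IsArtinCorrespondent`, `finiteIdeleClass`
import HarnessLib

/-!
# Artin correspondents invert, over ANY number field (the reflex compositum `E♯` of the sheet line has no `IsCMField` instance)
# ([Milne 2005] (59) p. 107: `art_L` and `θ_L` are homomorphisms)

Topic `AlgebraicGeometry/ShimuraVarieties`, namespace `…ShimuraVarieties.UnitaryCanonicalModel`.  THEOREMS ONLY (no definition, no instance, no named fact,
no `sorry`).  Cell `hodgecm-mathlib` (D-0151), P6 «MOD programme», crux hLiu418 (stmt-HodgeConjecture-24832, `--supports`, count-neutral), line «L4», X-LEAF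
`Lines/F0_P6a_EExports.lean` (A-p01 (g28)) socket `stub_ESHEET`, (S8) junction §1 (A-p01 (g28) 2026-09-02T06:45:14Z): the central factor is pinned as
«`z · t(sE) = 1` for an exact correspondent `sE ↔ γ̃` of the REFLEX COMPOSITUM `E♯`», and the geometric organ (S3♯) (★
`F0P6aSpecialPairForwardLawAtCorrespondent.exists_forward_law_of_correspondent`) reads the tensored slice with central factor `t(uE)` for `uE ↔ σ`; matching the two
takes `uE := sE⁻¹ ↔ γ̃⁻¹` — ★ `IsArtinCorrespondent.inv` of `UnitaryShimuraComplexGaloisDatumAssembly` is stated under `[IsCMField L]`, which `↥E♯` does not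
carry; its proof uses only that `art_L`, `θ_L` are homomorphisms.  §1 **`IsArtinCorrespondent.inv'`** — the same over any number field; **`IsArtinCorrespondent.symm'`**
(`σ.symm`), **`IsArtinCorrespondent.inv_algEquiv`** (`σ : ℂ ≃ₐ[ℚ] ℂ` packaging); the junction arithmetic `z · N(u) = 1 ⇒ z = N(u⁻¹)` is then Mathlib's `eq_inv_of_mul_eq_one_left` + `map_inv` for the monoid hom ★ `reflexNormFiniteIdele`.
HONEST LABEL: HC_CM is proved only modulo the 2 remaining named inputs (hLiu418 24832, h413 24833) until rung 0 closes; this file is generic and count-neutral.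

## References
* [Milne2005ShimuraVarieties] J. S. Milne, *Introduction to Shimura varieties* (2005), (59) p. 107 and p. 107 L9–15; Def. 12.8 (62) p. 114.
* [Deligne1979ShimuraVarieties] P. Deligne, *Variétés de Shimura* (1979), 0.8 and 2.2.3.
-/

set_option autoImplicit false

noncomputable section

open NumberField IsDedekindDomain

namespace Literature.AlgebraicGeometry.ShimuraVarieties.UnitaryCanonicalModel

variable {L : Type} [Field L] [NumberField L]

/-! ### §1 Inverses of Artin correspondents over any number field -/

/-- **Artin correspondents invert (any number field)**: if `s ↔ σ` under `art_L` (read through an `L`-embedding `L̄ → ℂ`), then `s⁻¹ ↔ σ⁻¹` — same embedding,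
inverse Galois element; `θ_L` and the idèle class map are homomorphisms.  (★ `IsArtinCorrespondent.inv` verbatim, without its idle `[IsCMField L]`.)
[cite: Milne2005ShimuraVarieties, (59) p. 107 and p. 107 L9–15] [cite: Deligne1979ShimuraVarieties, 0.8 and 2.2.3] -/
theorem IsArtinCorrespondent.inv' (τ : L →+* ℂ) {s : (FiniteAdeleRing (𝓞 L) L)ˣ} {σ : ℂ ≃+* ℂ}
    (hs : IsArtinCorrespondent L τ s σ) : IsArtinCorrespondent L τ s⁻¹ σ⁻¹ := by
  letI : Algebra L ℂ := τ.toAlgebra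
  obtain ⟨e, γ, he, hγ⟩ := hs
  refine ⟨e, γ⁻¹, fun x => ?_, ?_⟩
  · rw [map_inv, AlgEquiv.aut_inv]
    have h := he ((Field.absoluteGaloisGroup.toAlgEquiv L γ).symm x)
    rw [AlgEquiv.apply_symm_apply] at h
    rw [h]
    exact (σ.symm_apply_apply _).symm
  · have hcls : finiteIdeleClass L s⁻¹ = (finiteIdeleClass L s)⁻¹ := by
      unfold finiteIdeleClass
      rw [map_inv]
      rfl
    rw [map_inv, hγ, hcls, map_inv]

/-- The same with `σ.symm` for `σ⁻¹` (the two agree in `ℂ ≃+* ℂ`). [cite: Milne2005ShimuraVarieties, (59) p. 107] -/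
theorem IsArtinCorrespondent.symm' (τ : L →+* ℂ) {s : (FiniteAdeleRing (𝓞 L) L)ˣ} {σ : ℂ ≃+* ℂ}
    (hs : IsArtinCorrespondent L τ s σ) : IsArtinCorrespondent L τ s⁻¹ σ.symm :=
  hs.inv' τ

/-- For `σ : ℂ ≃ₐ[ℚ] ℂ` (the packaging of ★ `exists_siegelRecipDatum_centralTwist_at` ∕ (S3♯)): `s ↔ σ` gives `s⁻¹ ↔ σ⁻¹`, read on `toRingEquiv`.
[cite: Milne2005ShimuraVarieties, (59) p. 107; Def. 12.8 (62) p. 114] -/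
theorem IsArtinCorrespondent.inv_algEquiv (τ : L →+* ℂ) {s : (FiniteAdeleRing (𝓞 L) L)ˣ} {σ : ℂ ≃ₐ[ℚ] ℂ}
    (hs : IsArtinCorrespondent L τ s σ.toRingEquiv) : IsArtinCorrespondent L τ s⁻¹ σ⁻¹.toRingEquiv :=
  hs.inv' τ

end Literature.AlgebraicGeometry.ShimuraVarieties.UnitaryCanonicalModel

end
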